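import Mathlib
import Literature.Analysis.Complex.JensenPolynomialHyperbolicity
import Literature.Analysis.Matrix.DetAddDiagonalMinors
import HarnessLib

/-!
# Nuij's theorem and the determinantal representation of the Nuij pencil `p + s p'`

Sources.  W. Nuij, *A note on hyperbolic polynomials*, Math. Scand. 23 (1968) 69–72
[cite: Nuij1968] (text not held: acq-13329; the statement used here is the one restated as Thm. 1.1
of the secondary source), and K. Kurdyka, L. Paunescu, *Nuij type pencils of hyperbolic polynomials*,
Canad. Math. Bull. 60 (2017) 561–570 = arXiv:1504.03665 (held text `paper:arxiv-1504.03665`, whose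
numbering we follow) [cite: KurdykaPaunescu2017].

A polynomial `p ∈ ℝ[z]` is *hyperbolic* if all its roots are real (the tree's `Polynomial.Splits`
over `ℝ`).  Nuij's theorem (KP Thm. 1.1): `p` hyperbolic ⇒ `p + s p'` hyperbolic for every real `s`.
KP §3 explains it by a symmetric determinantal representation of the pencil: for
`p = (z + μ₁)⋯(z + μ_d)`, `p + s p' = det(zI + D + s T_{1,1})` with `D = diag(μ)` and `T_{1,1}` the
all-ones matrix (Example 3.6, the case `a = (1,0,…,0)`, `α = β = 1` of Theorem B), and a real
symmetric matrix has a hyperbolic characteristic polynomial.  More generally (Thm. B, «if»), every special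
Toeplitz matrix `T_{α,β}` represents the pencil of the sequence `t_{α,β}(i)/i!` universally, which is
therefore a Nuij sequence.

## Dictionary (source item → Lean → status)

| Source | Lean | Status |
|---|---|---|
| KP Thm. 1.1 = Nuij 1968 (`p` hyperbolic ⇒ `p + sp'` hyperbolic) | `nuij_theorem` (via the tree's Hermite–Poulain lemma `Literature.Analysis.Complex.PolyaSchur.splits_derivative_sub_C_mul`), `nuij_theorem_of_monic_det` (KP's determinantal proof, Example 3.6) | proved (twice) |
| KP Def. 1.2 (Nuij sequence `a ∈ ℝ^d`: `p + Σ a_k s^k p^{(k)}` hyperbolic for all hyperbolic `p` of degree `d`, all `s`) | `kpPencil`, `IsNuijSequence` | def |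
| KP §1: `(1,0,…,0)` and `(2,1,0,…,0)` are Nuij sequences | `nuijSeq`, `twoOneSeq`, `kpPencil_nuijSeq`, `isNuijSequence_nuijSeq`, `kpPencil_twoOneSeq`, `isNuijSequence_twoOneSeq`, `nuij_theorem_iterate` | proved |
| KP Def. 1.3 / §3 (universal determinantal representation `p_a(z,s) = det(zI + D + sA_a)`) | `HasUniversalDetRep` | def |
| KP §3.1, special Toeplitz matrices `T_{α,β}(d)`; Lemma 3.5 `det T_{α,β}(d) = (α−β)^{d−1}(α+(d−1)β)` | `specialToeplitz`, `det_specialToeplitz` (size `d + 1`) | def + proved |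
| KP Example 3.6 (`T_{1,1}` represents the Nuij pencil: `p + sp' = det(zI + D + sT_{1,1})`; «this also proves Nuij's Theorem») | `nuijPencilMatrix`, `det_nuijPencilMatrix` (any field), `hasUniversalDetRep_nuijSeq`, `nuij_theorem_of_monic_det` | def + proved |
| KP Rem. 3.7 (`(2,1,0,…,0)` has no universal representation for `d ≥ 3`: no `α, β` with `t(1) = 2`, `t(2)/2 = 1`, `t(3)/3! = 0`) | `rem_3_7_no_specialToeplitz` (no special Toeplitz `T_{α,β}` matches `(2,1,0)` in sizes `1,2,3`) | proved; the reduction of Rem. 3.7 to this (every universal representation may be taken special Toeplitz) is Prop. 3.2 / Thm. B (⇒), not typed |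
| KP Thm. B, «if» direction (every special Toeplitz `T_{α,β}` gives the Nuij sequence `a_i = t_{α,β}(i)/i!` with universal representation `p_a(z,s) = det(zI + D + sT_{α,β})`) | `toeplitzDet`, `det_specialToeplitz_card`, `specialToeplitz_submatrix`, `det_pencil_specialToeplitz` (any commutative ring, with Hasse derivatives `p^{(k)}/k!`; principal-minor expansion = tree `Literature.Analysis.Matrix.det_add_diagonal_eq_sum_minors`), `toeplitzSeq`, `kpPencil_toeplitzSeq`, `hasUniversalDetRep_toeplitzSeq`, `isNuijSequence_toeplitzSeq` | def + proved |
| KP §2.1 (composition `b ∘ a = c`, `c_k = Σ a_i b_{k−i}`, eq. (2.1); `(p_a)_b = p_c`; iterations of `(x_i,0,…,0)` give the Viète sequences `c_k = e_k(x)`, eqs. (2.2)–(2.3); `𝓗_1^d ⊂ 𝓝_d`, Cor. 2.4 first inclusion) | `seqCoeff`, `kpComp`, `seqPoly`, `kpPencil_eq_aeval` (`p_a = A(D)p`), `kpPencil_kpPencil`, `natDegree_kpPencil`, `IsNuijSequence.comp`, `singleSeq`, `isNuijSequence_singleSeq`, `kpComp_esymm_singleSeq`, `isNuijSequence_esymm`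 (every `(e_k(X))_k`, `X` a finite multiset of reals, is a Nuij sequence) | def + proved |
| KP Thm. A, «only if» (`a` Nuij ⇒ `q_a = p_a(z,1)|_{p = z^d}` hyperbolic) | `qPoly`, `IsNuijSequence.splits_qPoly` | proved (trivial direction) |
| KP Example 2.5 (`d = 2`: `𝓗_1^2 = {a_1² − 4a_2 ≥ 0} ⊂ 𝓝_2 = {a_1² − 2a_2 ≥ 0}`) | `isNuijSequence_two_iff` (`𝓝_2`, proved DIRECTLY by the discriminant `(u−v)² + 4s²(a_1² − 2a_2)`, not via Thm. A), `viete_two_iff` (`𝓗_1^2`), `example_2_5_inclusion` | proved |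
| KP Thm. A «if» (Borcea–Brändén), Cor. 2.4 (equality `𝓝_d = b_d^{-1}(𝓗_1^d)` for general `d`), Thm. 3.1 (Helton–Vinnikov), Prop. 3.2 / Lemmas 3.3–3.4 / Thm. B «only if» (every universal representation is special Toeplitz) | — | NOT typed (Borcea–Brändén and Helton–Vinnikov are not in Mathlib; Prop. 3.2's coefficient comparison is not typed); no fact is vendored |

## Typed-vs-printed

* «hyperbolic» = `Polynomial.Splits` over `ℝ` (all roots real; the zero polynomial is allowed by
  both the source's wording and `Splits`).  «degree `d`» in Def. 1.2 = `natDegree p = d`.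
* KP index their sequences `a = (a_1,…,a_d)`; `kpPencil a d p s = p + Σ_{k=1}^{d} a k · s^k · p^{(k)}`
  takes `a : ℕ → ℝ` and ignores `a 0` and `a k` for `k > d`.
* Lemma 3.5 is stated for size `d + 1` (`(α−β)^d (α + dβ)`), i.e. the printed formula for `T(d+1)`;
  for `d = 0` the printed `T(0)` is the empty matrix, not covered by the printed formula.
* Def. 1.3's `D` is «a diagonal matrix whose characteristic polynomial is `p`», `−D` carrying the
  roots; we write `p = ∏ (z + μ_i)` and `D = diag(μ)` as in the proof of Thm. B.

Honest framing: dictionary literature for the V1 line (hyperbolic polynomials and symmetric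
determinantal representations of pencils); nothing here bears on lower bounds for the permanent.
-/

noncomputable section

namespace Literature.AlgebraicGeometry.DeterminantalHypersurfaces.KurdykaPaunescu2017

open Polynomial Matrix Finset

/-! ## Nuij's theorem -/

/-- **Nuij 1968 (as restated in KP, Thm. 1.1).** If `p ∈ ℝ[z]` is hyperbolic (all roots real), then
so is `p + s p'` for every `s ∈ ℝ`.  Proof: for `s ≠ 0`, `p + sp' = s·(p' − (−1/s)p)`, and
`p' − a p` is hyperbolic by the Hermite–Poulain lemma (tree:
`Literature.Analysis.Complex.PolyaSchur.splits_derivative_sub_C_mul`). [cite: Nuij1968, Theorem (restated as KurdykaPaunescu2017 Thm. 1.1)]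
[cite: KurdykaPaunescu2017, Thm. 1.1] -/
theorem nuij_theorem {p : ℝ[X]} (hp : p.Splits) (s : ℝ) : (p + C s * derivative p).Splits := by
  by_cases hs : s = 0
  · simpa [hs] using hp
  · have h := (Literature.Analysis.Complex.PolyaSchur.splits_derivative_sub_C_mul hp (-s⁻¹)).mul (Splits.C s)
    have heq : (derivative p - C (-s⁻¹) * p) * C s = p + C s * derivative p := by
      rw [sub_mul, map_neg, neg_mul, neg_mul, sub_neg_eq_add, mul_assoc, mul_comm p, ← mul_assoc,
        ← map_mul, inv_mul_cancel₀ hs, map_one, one_mul, add_comm, mul_comm]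
    rwa [heq] at h

/-- Iterating Nuij's theorem: all `p + s p'`-type perturbations of iterates stay hyperbolic; in
particular `(p + sp') + s(p + sp')'` is hyperbolic. [cite: KurdykaPaunescu2017, §1 (after Def. 1.2)] -/
theorem nuij_theorem_iterate {p : ℝ[X]} (hp : p.Splits) (s : ℝ) :
    ((p + C s * derivative p) + C s * derivative (p + C s * derivative p)).Splits :=
  nuij_theorem (nuij_theorem hp s) s

/-! ## Nuij sequences (KP Def. 1.2) -/

/-- The pencil `p_a(z,s) = p(z) + Σ_{k=1}^{d} a_k s^k p^{(k)}(z)` of KP (1.1)/Def. 1.2, for a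
coefficient sequence `a` (only `a 1, …, a d` are used). [cite: KurdykaPaunescu2017, Def. 1.2 (eq. (1.1))] -/
def kpPencil {R : Type*} [CommRing R] (a : ℕ → R) (d : ℕ) (p : R[X]) (s : R) : R[X] :=
  p + ∑ k ∈ Finset.Icc 1 d, C (a k * s ^ k) * derivative^[k] p

/-- Unfolding `kpPencil`. [cite: KurdykaPaunescu2017, Def. 1.2 (eq. (1.1))] -/
theorem kpPencil_def {R : Type*} [CommRing R] (a : ℕ → R) (d : ℕ) (p : R[X]) (s : R) :
    kpPencil a d p s = p + ∑ k ∈ Finset.Icc 1 d, C (a k * s ^ k) * derivative^[k] p := rfl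

/-- **KP Def. 1.2.** `a` is a *Nuij sequence* (in `ℝ^d`) if for every hyperbolic `p` of degree `d`
the polynomial `p_a(z,s)` is hyperbolic for every `s ∈ ℝ`. [cite: KurdykaPaunescu2017, Def. 1.2] -/
def IsNuijSequence (d : ℕ) (a : ℕ → ℝ) : Prop :=
  ∀ p : ℝ[X], p.natDegree = d → p.Splits → ∀ s : ℝ, (kpPencil a d p s).Splits

/-- The original Nuij sequence `(1, 0, …, 0)`. [cite: KurdykaPaunescu2017, §1 (after Def. 1.2)] -/
def nuijSeq : ℕ → ℝ := fun k => if k = 1 then 1 else 0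

/-- The composed sequence `(2, 1, 0, …, 0)`. [cite: KurdykaPaunescu2017, §1 (after Def. 1.2) and Rem. 3.7] -/
def twoOneSeq : ℕ → ℝ := fun k => if k = 1 then 2 else if k = 2 then 1 else 0

/-- For `a = (1,0,…,0)` and `d ≥ 1` the pencil is `p + s p'`. [cite: KurdykaPaunescu2017, §1 (after Def. 1.2)] -/
theorem kpPencil_nuijSeq (d : ℕ) (hd : 1 ≤ d) (p : ℝ[X]) (s : ℝ) :
    kpPencil nuijSeq d p s = p + C s * derivative p := by
  rw [kpPencil_def, Finset.sum_eq_single_of_mem 1 (Finset.mem_Icc.mpr ⟨le_rfl, hd⟩)]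
  · simp [nuijSeq]
  · intro k hk hk1
    simp [nuijSeq, hk1]

/-- **KP §1:** «by Theorem 1.1, `a = (1,0,…,0)` is a Nuij sequence for any `d ≥ 1`».
[cite: KurdykaPaunescu2017, §1 (after Def. 1.2)] -/
theorem isNuijSequence_nuijSeq (d : ℕ) (hd : 1 ≤ d) : IsNuijSequence d nuijSeq := by
  intro p _ hp s
  rw [kpPencil_nuijSeq d hd]
  exact nuij_theorem hp s

/-- For `a = (2,1,0,…,0)` and `d ≥ 2` the pencil is `p + 2sp' + s²p'' = (p + sp') + s(p + sp')'`.
[cite: KurdykaPaunescu2017, §1 (display after Def. 1.2)] -/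
theorem kpPencil_twoOneSeq (d : ℕ) (hd : 2 ≤ d) (p : ℝ[X]) (s : ℝ) :
    kpPencil twoOneSeq d p s =
      (p + C s * derivative p) + C s * derivative (p + C s * derivative p) := by
  rw [kpPencil_def]
  have hsplit : Finset.Icc 1 d = insert 1 (insert 2 (Finset.Icc 3 d)) := by
    ext k
    simp only [Finset.mem_Icc, Finset.mem_insert]
    omega
  have h1 : twoOneSeq 1 = 2 := by simp [twoOneSeq]
  have h2 : twoOneSeq 2 = 1 := by simp [twoOneSeq]
  rw [hsplit, Finset.sum_insert (by simp), Finset.sum_insert (by simp),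
    Finset.sum_eq_zero (fun k hk => by
      rw [Finset.mem_Icc] at hk
      simp [twoOneSeq, show k ≠ 1 by omega, show k ≠ 2 by omega]), h1, h2, add_zero, pow_one, one_mul,
    map_mul, map_pow, Function.iterate_succ, Function.iterate_succ, Function.iterate_zero,
    Function.iterate_one, derivative_add, derivative_mul, derivative_C, zero_mul, zero_add,
    show (C (2 : ℝ) : ℝ[X]) = 2 from map_ofNat C 2]
  simp only [Function.comp_apply, id_eq]
  ring

/-- **KP §1:** «`p + sp' + s(p + sp')' = p + 2sp' + s²p''`.  Hence `(2,1,0,…,0)` is a Nuij sequence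
for any `d ≥ 2`». [cite: KurdykaPaunescu2017, §1 (after Def. 1.2)] -/
theorem isNuijSequence_twoOneSeq (d : ℕ) (hd : 2 ≤ d) : IsNuijSequence d twoOneSeq := by
  intro p _ hp s
  rw [kpPencil_twoOneSeq d hd]
  exact nuij_theorem_iterate hp s

/-! ## Special Toeplitz matrices (KP §3.1) -/

/-- The *special* symmetric Toeplitz matrix `T_{α,β}`: `α` on the diagonal, `β` elsewhere.
[cite: KurdykaPaunescu2017, §3.1 (before Prop. 3.2)] -/
def specialToeplitz {R : Type*} [CommRing R] {n : Type*} [DecidableEq n] (α β : R) : Matrix n n R :=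
  Matrix.of fun i j => if i = j then α else β

/-- Entries of `T_{α,β}`. [cite: KurdykaPaunescu2017, §3.1] -/
theorem specialToeplitz_apply {R : Type*} [CommRing R] {n : Type*} [DecidableEq n] (α β : R)
    (i j : n) : specialToeplitz α β i j = if i = j then α else β := rfl

/-- `T_{α,β}` is symmetric. [cite: KurdykaPaunescu2017, §3.1] -/
theorem specialToeplitz_isSymm {R : Type*} [CommRing R] {n : Type*} [DecidableEq n] (α β : R) :
    (specialToeplitz α β : Matrix n n R).IsSymm := by
  ext i j
  simp only [transpose_apply, specialToeplitz_apply, eq_comm]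

/-- `T_{α,β} = (α − β) I + β T_{1,1}`. [cite: KurdykaPaunescu2017, §3.1] -/
theorem specialToeplitz_eq {R : Type*} [CommRing R] {n : Type*} [DecidableEq n] (α β : R) :
    (specialToeplitz α β : Matrix n n R) = (α - β) • 1 + β • Matrix.of fun _ _ => 1 := by
  ext i j
  by_cases h : i = j <;> simp [specialToeplitz_apply, h]

/-- Division-free rank-one determinant formula for `c I + β 𝟙𝟙ᵀ` of size `d + 1`:
`det = c^d (c + (d+1) β)`.  (Row `i ≥ 1` minus row `0`, then column `0` plus the other columns,
leaves a triangular matrix.) [folklore] -/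
private theorem det_smul_one_add_smul_ones {R : Type*} [CommRing R] (c β : R) (d : ℕ) :
    ((c • (1 : Matrix (Fin (d + 1)) (Fin (d + 1)) R)) + β • Matrix.of fun _ _ => (1 : R)).det =
      c ^ d * (c + (d + 1 : ℕ) * β) := by
  set A : Matrix (Fin (d + 1)) (Fin (d + 1)) R := c • 1 + β • Matrix.of fun _ _ => (1 : R) with hA
  have hAij : ∀ i j, A i j = (if i = j then c else 0) + β := by
    intro i j
    simp only [hA, Matrix.add_apply, Matrix.smul_apply, Matrix.one_apply, Matrix.of_apply,
      smul_eq_mul, mul_one, mul_ite, mul_zero]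
  -- Step 1: subtract row 0 from the rows `i ≠ 0`.
  set B : Matrix (Fin (d + 1)) (Fin (d + 1)) R :=
    Matrix.of fun i j => if i = 0 then A 0 j else A i j - A 0 j with hB
  have hAB : A.det = B.det := by
    refine Matrix.det_eq_of_forall_row_eq_smul_add_const (fun i => if i = 0 then 0 else 1) 0
      (by simp) fun i j => ?_
    by_cases hi : i = 0
    · simp [hB, hi]
    · simp [hB, hi]
  -- Step 2: add the columns `j ≠ 0` to column 0 (right multiplication by a unipotent matrix `E`).
  set Cm : Matrix (Fin (d + 1)) (Fin (d + 1)) R :=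
    Matrix.of fun i j => if j = 0 then ∑ k, B i k else B i j with hCm
  set E : Matrix (Fin (d + 1)) (Fin (d + 1)) R :=
    Matrix.of fun i j => if j = 0 then 1 else if i = j then 1 else 0 with hE
  have hCE : Cm = B * E := by
    ext i j
    simp only [hCm, hE, Matrix.mul_apply, Matrix.of_apply]
    by_cases hj : j = 0
    · simp [hj]
    · simp [hj, Finset.sum_ite_eq']
  have hEdet : E.det = 1 := by
    have hlow : E.BlockTriangular OrderDual.toDual := by
      intro i j hij
      have hij' : i < j := hij
      have hj : j ≠ 0 := fun h => by rw [h] at hij'; exact (Fin.not_lt_zero _ hij' : False)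
      simp [hE, hj, hij'.ne]
    rw [Matrix.det_of_lowerTriangular E hlow]
    refine Finset.prod_eq_one fun i _ => ?_
    by_cases hi : i = 0 <;> simp [hE, hi]
  have hBC : B.det = Cm.det := by rw [hCE, det_mul, hEdet, mul_one]
  -- `Cm` is upper triangular with diagonal `(c + (d+1)β, c, …, c)`
  have hrow : ∀ i, ∑ k, A i k = c + (d + 1 : ℕ) * β := by
    intro i
    simp only [hAij, Finset.sum_add_distrib, Finset.sum_ite_eq, Finset.mem_univ, if_true,
      Finset.sum_const, Finset.card_univ, Fintype.card_fin, nsmul_eq_mul]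
  have hCij : ∀ i j, Cm i j = if j = 0 then (if i = 0 then c + (d + 1 : ℕ) * β else 0)
      else (if i = 0 then A 0 j else A i j - A 0 j) := by
    intro i j
    simp only [hCm, hB, Matrix.of_apply]
    by_cases hj : j = 0
    · simp only [hj, if_true]
      by_cases hi : i = 0
      · simp only [hi, if_true, hrow]
      · simp only [hi, if_false, Finset.sum_sub_distrib, hrow, sub_self]
    · simp only [hj, if_false]
  have hup : Cm.BlockTriangular id := by
    intro i j hij
    have hij' : j < i := hij
    have hi : i ≠ 0 := fun h => by rw [h] at hij'; exact (Fin.not_lt_zero _ hij' : False)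
    rw [hCij]
    by_cases hj : j = 0
    · simp [hj, hi]
    · simp only [hj, if_false, hi, hAij, hij'.ne', (Ne.symm hj : (0 : Fin (d + 1)) ≠ j)]
      simp
  rw [hAB, hBC, Matrix.det_of_upperTriangular hup, Fin.prod_univ_succ]
  have h0 : Cm 0 0 = c + (d + 1 : ℕ) * β := by rw [hCij]; simp
  have hi : ∀ i : Fin d, Cm i.succ i.succ = c := by
    intro i
    rw [hCij]
    simp [Fin.succ_ne_zero, hAij, (Fin.succ_ne_zero i).symm]
  rw [h0, Finset.prod_congr rfl fun i _ => hi i, Finset.prod_const, Finset.card_univ,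
    Fintype.card_fin, mul_comm]

/-- **KP Lemma 3.5.** `det T_{α,β}(d) = (α−β)^{d−1}(α + (d−1)β)`; typed for size `d + 1`:
`det T_{α,β}(d+1) = (α−β)^d (α + dβ)`. [cite: KurdykaPaunescu2017, Lemma 3.5] -/
theorem det_specialToeplitz {R : Type*} [CommRing R] (α β : R) (d : ℕ) :
    (specialToeplitz α β : Matrix (Fin (d + 1)) (Fin (d + 1)) R).det =
      (α - β) ^ d * (α + (d : R) * β) := by
  rw [specialToeplitz_eq, det_smul_one_add_smul_ones]
  push_cast
  ring

/-! ## The universal determinantal representation of the Nuij pencil (KP §3, Example 3.6) -/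

/-- The matrix `zI + D + s T_{1,1}` over `R[z]` (`D = diag(μ)`), KP Def. 1.3 / §3 for the Nuij
sequence `a = (1,0,…,0)` with associated matrix `A_a = T_{1,1}` (all entries `1`, Example 3.6).
[cite: KurdykaPaunescu2017, Def. 1.3 and Example 3.6] -/
def nuijPencilMatrix {R : Type*} [CommRing R] {n : Type*} [DecidableEq n] [Fintype n]
    (μ : n → R) (s : R) : Matrix n n R[X] :=
  (X : R[X]) • 1 + (Matrix.diagonal μ).map C + C s • Matrix.of fun _ _ => 1

/-- Entries of `zI + D + sT_{1,1}`. [cite: KurdykaPaunescu2017, Def. 1.3 and Example 3.6] -/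
theorem nuijPencilMatrix_apply {R : Type*} [CommRing R] {n : Type*} [DecidableEq n] [Fintype n]
    (μ : n → R) (s : R) (i j : n) :
    nuijPencilMatrix μ s i j = (if i = j then X + C (μ i) else 0) + C s := by
  by_cases h : i = j
  · subst h; simp [nuijPencilMatrix]
  · simp [nuijPencilMatrix, h]

/-- Rank-one update of an invertible diagonal matrix over a field:
`det(diag(a) + t·𝟙𝟙ᵀ) = ∏ a_i + t Σ_i ∏_{j≠i} a_j` (matrix determinant lemma). [folklore] -/
private theorem det_diagonal_add_const {K : Type*} [Field K] {n : Type*} [DecidableEq n] [Fintype n]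
    (a : n → K) (ha : ∀ i, a i ≠ 0) (t : K) :
    (Matrix.diagonal a + Matrix.of fun _ _ => t).det =
      ∏ i, a i + t * ∑ i, ∏ j ∈ Finset.univ.erase i, a j := by
  have hdet : IsUnit (Matrix.diagonal a).det := by
    rw [det_diagonal]
    exact (Finset.prod_ne_zero_iff.mpr fun i _ => ha i).isUnit
  have hJ : (Matrix.of fun (_ : n) (_ : n) => t) =
      Matrix.replicateCol Unit (fun _ => t) * Matrix.replicateRow Unit (fun _ => (1 : K)) := by
    ext i j
    simp [Matrix.mul_apply]
  have hinv : (Matrix.diagonal a)⁻¹ = Matrix.diagonal fun i => (a i)⁻¹ := by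
    refine Matrix.inv_eq_left_inv ?_
    rw [diagonal_mul_diagonal, ← diagonal_one]
    congr 1
    funext i
    exact inv_mul_cancel₀ (ha i)
  rw [hJ, Matrix.det_add_mul _ _ hdet, det_diagonal, Matrix.mul_assoc, ← Matrix.replicateCol_mulVec,
    det_unique, Matrix.add_apply, Matrix.one_apply_eq, Matrix.replicateRow_mul_replicateCol_apply,
    hinv, mul_add, mul_one]
  congr 1
  have hmv : (Matrix.diagonal (fun i => (a i)⁻¹) *ᵥ fun _ => t) = fun i => (a i)⁻¹ * t := by
    funext i
    rw [mulVec_diagonal]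
  rw [hmv, dotProduct, Finset.mul_sum, Finset.mul_sum]
  refine Finset.sum_congr rfl fun i _ => ?_
  rw [one_mul, ← Finset.prod_erase_mul _ _ (Finset.mem_univ i), mul_assoc, ← mul_assoc (a i),
    mul_inv_cancel₀ (ha i), one_mul, mul_comm]

/-- **KP Example 3.6 (Theorem B for `a = (1,0,…,0)`, `α = β = 1`):** for `p = ∏ (z + μ_i)`,
`det(zI + D + sT_{1,1}) = p + s p'` — the universal determinantal representation of the Nuij pencil.
(Any field of coefficients.) [cite: KurdykaPaunescu2017, Example 3.6 (with Def. 1.3, Thm. B)] -/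
theorem det_nuijPencilMatrix {F : Type*} [Field F] {n : Type*} [DecidableEq n] [Fintype n]
    (μ : n → F) (s : F) :
    (nuijPencilMatrix μ s).det =
      ∏ i, (X + C (μ i)) + C s * derivative (∏ i, (X + C (μ i))) := by
  -- compare both sides in the fraction field of `F[z]`, where `diag(z + μ_i)` is invertible
  let K := FractionRing F[X]
  let φ : F[X] →+* K := algebraMap F[X] K
  have hφ : Function.Injective φ := IsFractionRing.injective F[X] K
  apply hφ
  have hmap : (nuijPencilMatrix μ s).map φ =
      Matrix.diagonal (fun i => φ (X + C (μ i))) + Matrix.of fun _ _ => φ (C s) := by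
    ext i j
    rw [Matrix.map_apply, nuijPencilMatrix_apply]
    by_cases h : i = j
    · subst h; simp
    · simp [h]
  have ha : ∀ i, φ (X + C (μ i)) ≠ 0 := fun i =>
    (map_ne_zero_iff φ hφ).mpr (X_add_C_ne_zero (μ i))
  rw [RingHom.map_det, RingHom.mapMatrix_apply, hmap, det_diagonal_add_const _ ha, map_add,
    map_prod, map_mul, derivative_prod_finset, map_sum]
  congr 1
  congr 1
  refine Finset.sum_congr rfl fun i _ => ?_
  rw [map_mul, map_prod, derivative_X_add_C, map_one, mul_one]

/-- **KP Def. 1.3.** The Nuij sequence `a` *admits a universal determinantal representation* if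
there is a symmetric `d × d` matrix `A_a` with `p_a(z,s) = det(zI + D + sA_a)` for every hyperbolic
`p = ∏_{i<d} (z + μ_i)` of degree `d`, `D = diag(μ)`. [cite: KurdykaPaunescu2017, Def. 1.3] -/
def HasUniversalDetRep (d : ℕ) (a : ℕ → ℝ) : Prop :=
  ∃ A : Matrix (Fin d) (Fin d) ℝ, A.IsSymm ∧
    ∀ (μ : Fin d → ℝ) (s : ℝ),
      kpPencil a d (∏ i, (X + C (μ i))) s =
        ((X : ℝ[X]) • 1 + (Matrix.diagonal μ).map C + C s • A.map C).det

/-- **KP Example 3.6:** «the original Nuij sequence `a = (1,0,…,0)` has a universal determinantal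
representation.  Indeed, `T_{1,1}`, which has all entries equal to `1`, is the matrix associated to
this sequence.» [cite: KurdykaPaunescu2017, Example 3.6] -/
theorem hasUniversalDetRep_nuijSeq (d : ℕ) (hd : 1 ≤ d) : HasUniversalDetRep d nuijSeq := by
  refine ⟨specialToeplitz 1 1, specialToeplitz_isSymm 1 1, fun μ s => ?_⟩
  rw [kpPencil_nuijSeq d hd, ← det_nuijPencilMatrix μ s, nuijPencilMatrix]
  congr 2
  ext i j
  simp [specialToeplitz_apply]

/-- A real symmetric matrix has a hyperbolic characteristic polynomial; in the form needed here:
`det(zI + M)` is hyperbolic for `M` real symmetric. [folklore] -/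
private theorem splits_det_X_add_of_isSymm {n : Type*} [DecidableEq n] [Fintype n]
    {M : Matrix n n ℝ} (hM : M.IsSymm) : (((X : ℝ[X]) • 1 + M.map C).det).Splits := by
  have hH : (-M).IsHermitian := by
    rw [Matrix.IsHermitian, conjTranspose_neg, neg_inj]
    ext i j
    simpa using congr_fun (congr_fun hM i) j
  have hchar : ((X : ℝ[X]) • 1 + M.map C) = Matrix.charmatrix (-M) := by
    ext i j
    by_cases h : i = j
    · subst h; simp
    · simp [h]
  rw [hchar, ← Matrix.charpoly, hH.charpoly_eq]
  exact Splits.prod fun i _ => by simp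

/-- **KP Example 3.6, «this also proves Nuij's Theorem»:** for MONIC hyperbolic `p`, `p + s p'` is
the characteristic-type determinant `det(zI + D + sT_{1,1})` of a real symmetric matrix, hence
hyperbolic.  (The general case, `nuij_theorem`, follows by scaling.) [cite: KurdykaPaunescu2017, Example 3.6] -/
theorem nuij_theorem_of_monic_det {p : ℝ[X]} (hmonic : p.Monic) (hp : p.Splits) (s : ℝ) :
    (p + C s * derivative p).Splits := by
  classical
  -- enumerate the roots: `p = ∏_{i < d} (z − r_i) = ∏ (z + μ_i)` with `μ = −r`
  have hprod := hp.eq_prod_roots_of_monic hmonic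
  set l := p.roots.toList with hl
  let μ : Fin l.length → ℝ := fun i => -l.get i
  have hp' : p = ∏ i, (X + C (μ i)) := by
    have h1 : ∏ i : Fin l.length, (X + C (μ i)) =
        (((univ : Finset (Fin l.length)).val.map l.get).map fun a => X - C a).prod := by
      rw [Multiset.map_map, ← Finset.prod_map_val]
      refine Finset.prod_congr rfl fun i _ => ?_
      simp [μ, sub_eq_add_neg]
    rw [h1, Fin.univ_val_map, List.ofFn_get, hl, Multiset.coe_toList]
    exact hprod
  have hM : nuijPencilMatrix μ s =
      (X : ℝ[X]) • 1 + (Matrix.diagonal μ + s • Matrix.of fun _ _ => (1 : ℝ)).map C := by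
    refine Matrix.ext fun i j => ?_
    rw [nuijPencilMatrix_apply]
    by_cases h : i = j
    · subst h; simp [add_assoc]
    · simp [h]
  have hsymm : (Matrix.diagonal μ + s • Matrix.of fun (_ : Fin l.length) _ => (1 : ℝ)).IsSymm := by
    refine (Matrix.isSymm_diagonal μ).add (Matrix.IsSymm.smul ?_ s)
    ext i j
    simp
  rw [hp', ← det_nuijPencilMatrix μ s, hM]
  exact splits_det_X_add_of_isSymm hsymm

/-- **KP Remark 3.7 (arithmetic core).** The sequence `b = (2,1,0,…,0)` is not of the form
`b_i = t_{α,β}(i)/i!` (`i = 1,2,3`): «`α = 2` and `α² − β² = 2`, hence `β = ±√2`; but then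
`6b_3 = α³ + 2β³ − 3αβ² ≠ 0`».  With Prop. 3.2 / Thm. B (not typed) this shows that `b` has no
universal determinantal representation for `d ≥ 3`. [cite: KurdykaPaunescu2017, Rem. 3.7] -/
theorem rem_3_7_no_specialToeplitz : ¬ ∃ α β : ℝ,
    twoOneSeq 1 = (specialToeplitz α β : Matrix (Fin 1) (Fin 1) ℝ).det / (Nat.factorial 1 : ℝ) ∧
    twoOneSeq 2 = (specialToeplitz α β : Matrix (Fin 2) (Fin 2) ℝ).det / (Nat.factorial 2 : ℝ) ∧
    twoOneSeq 3 = (specialToeplitz α β : Matrix (Fin 3) (Fin 3) ℝ).det / (Nat.factorial 3 : ℝ) := by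
  rintro ⟨α, β, h1, h2, h3⟩
  have e1 : (specialToeplitz α β : Matrix (Fin 1) (Fin 1) ℝ).det = α := by
    simpa using det_specialToeplitz α β 0
  have e2 : (specialToeplitz α β : Matrix (Fin 2) (Fin 2) ℝ).det = (α - β) * (α + β) := by
    simpa using det_specialToeplitz α β 1
  have e3 : (specialToeplitz α β : Matrix (Fin 3) (Fin 3) ℝ).det = (α - β) ^ 2 * (α + 2 * β) := by
    have h := det_specialToeplitz α β 2
    norm_num at h
    rw [h]
  have t1 : twoOneSeq 1 = 2 := by simp [twoOneSeq]
  have t2 : twoOneSeq 2 = 1 := by simp [twoOneSeq]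
  have t3 : twoOneSeq 3 = 0 := by simp [twoOneSeq]
  rw [t1, e1, Nat.factorial_one, Nat.cast_one, div_one] at h1
  rw [t2, e2, eq_div_iff (by positivity)] at h2
  rw [t3, e3, eq_div_iff (by positivity), zero_mul] at h3
  norm_num [Nat.factorial] at h2
  -- `α = 2`, `β² = 2`, `(2 − β)²(2 + 2β) = 0`: impossible
  subst h1
  have v : β ^ 2 = 2 := by linear_combination h2
  have u : 2 * β ^ 3 - 6 * β ^ 2 + 8 = 0 := by linear_combination -h3
  have hb : β = 1 := by linear_combination (1 / 4 : ℝ) * u - ((2 * β - 6) / 4) * v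
  rw [hb] at v
  norm_num at v

/-! ## Theorem B (⇐): special Toeplitz matrices give Nuij sequences with universal representations -/

section ThmB

/-- `t_{α,β}(k) = det T_{α,β}(k) = (α−β)^{k−1}(α + (k−1)β)` for `k ≥ 1`, and `t(0) = 1` (empty
determinant). [cite: KurdykaPaunescu2017, Lemma 3.5 (eq. (3.1))] -/
def toeplitzDet {R : Type*} [CommRing R] (α β : R) : ℕ → R
  | 0 => 1
  | k + 1 => (α - β) ^ k * (α + (k : R) * β)

/-- `t(0) = 1`. [cite: KurdykaPaunescu2017, Lemma 3.5] -/
@[simp] theorem toeplitzDet_zero {R : Type*} [CommRing R] (α β : R) : toeplitzDet α β 0 = 1 := rfl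

/-- `t(k+1) = (α−β)^k (α + kβ)`. [cite: KurdykaPaunescu2017, Lemma 3.5] -/
theorem toeplitzDet_succ {R : Type*} [CommRing R] (α β : R) (k : ℕ) :
    toeplitzDet α β (k + 1) = (α - β) ^ k * (α + (k : R) * β) := rfl

/-- `t_{α,β}` commutes with ring maps. [cite: KurdykaPaunescu2017, Lemma 3.5] -/
theorem map_toeplitzDet {R S : Type*} [CommRing R] [CommRing S] (f : R →+* S) (α β : R) (k : ℕ) :
    f (toeplitzDet α β k) = toeplitzDet (f α) (f β) k := by
  cases k with
  | zero => simp
  | succ k => simp [toeplitzDet_succ]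

/-- Principal submatrices of `T_{α,β}` are special Toeplitz matrices `T_{α,β}` of the smaller size.
[cite: KurdykaPaunescu2017, §3.1 (Lemma 3.3, principal minors)] -/
theorem specialToeplitz_submatrix {R : Type*} [CommRing R] {m n : Type*} [DecidableEq m]
    [DecidableEq n] (α β : R) (f : m → n) (hf : Function.Injective f) :
    (specialToeplitz α β : Matrix n n R).submatrix f f = specialToeplitz α β := by
  ext i j
  simp only [submatrix_apply, specialToeplitz_apply, hf.eq_iff]

/-- `T_{α,β}` commutes with ring maps. [cite: KurdykaPaunescu2017, §3.1] -/
theorem specialToeplitz_map {R S : Type*} [CommRing R] [CommRing S] {n : Type*} [DecidableEq n]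
    (f : R →+* S) (α β : R) :
    (specialToeplitz α β : Matrix n n R).map f = specialToeplitz (f α) (f β) := by
  ext i j
  simp only [map_apply, specialToeplitz_apply]
  split_ifs <;> rfl

/-- **KP Lemma 3.5 for any finite index type:** `det T_{α,β} = t_{α,β}(#indices)`.
[cite: KurdykaPaunescu2017, Lemma 3.5] -/
theorem det_specialToeplitz_card {R : Type*} [CommRing R] {m : Type*} [Fintype m] [DecidableEq m]
    (α β : R) : (specialToeplitz α β : Matrix m m R).det = toeplitzDet α β (Fintype.card m) := by
  have h : (specialToeplitz α β : Matrix m m R) =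
      (specialToeplitz α β : Matrix (Fin (Fintype.card m)) (Fin (Fintype.card m)) R).submatrix
        (Fintype.equivFin m) (Fintype.equivFin m) :=
    (specialToeplitz_submatrix α β _ (Fintype.equivFin m).injective).symm
  rw [h, Matrix.det_submatrix_equiv_self]
  generalize Fintype.card m = c
  cases c with
  | zero => simp [toeplitzDet]
  | succ d => rw [det_specialToeplitz, toeplitzDet_succ]

/-- **Hasse derivatives of a product of monic linear factors:**
`D^{(k)}/k! ∏_{i∈U} (z + c_i) = Σ_{S ⊆ U, |S| = k} ∏_{i ∈ U∖S} (z + c_i)`. [folklore] -/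
private theorem hasseDeriv_prod_X_add_C {R : Type*} [CommRing R] {ι : Type*} [DecidableEq ι]
    (c : ι → R) (U : Finset ι) :
    ∀ k : ℕ, hasseDeriv k (∏ i ∈ U, (X + C (c i))) =
      ∑ S ∈ U.powersetCard k, ∏ i ∈ U \ S, (X + C (c i)) := by
  induction U using Finset.induction_on with
  | empty =>
    intro k
    cases k with
    | zero => simp
    | succ k =>
      rw [Finset.prod_empty, hasseDeriv_apply_one _ (Nat.succ_pos k),
        Finset.powersetCard_eq_empty.mpr (by simp), Finset.sum_empty]
  | insert a U ha ih =>
    intro k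
    rw [Finset.prod_insert ha, hasseDeriv_mul]
    cases k with
    | zero =>
      rw [Finset.Nat.antidiagonal_zero, Finset.sum_singleton, hasseDeriv_zero', hasseDeriv_zero',
        Finset.powersetCard_zero, Finset.sum_singleton, Finset.sdiff_empty, Finset.prod_insert ha]
    | succ k =>
      -- `antidiagonal (k+1) = {(0,k+1)} ∪ {(i+1,j) : i+j = k}`; only `i = 0` survives since the
      -- Hasse derivatives of order `≥ 2` of `z + c_a` vanish
      rw [Finset.Nat.antidiagonal_succ, Finset.sum_cons, Finset.sum_map,
        Finset.sum_eq_single_of_mem (0, k) (Finset.HasAntidiagonal.mem_antidiagonal.mpr (zero_add k))]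
      · simp only [Function.Embedding.coe_prodMap, Function.Embedding.coeFn_mk, Prod.map_apply,
          Function.Embedding.refl_apply, Nat.succ_eq_add_one, zero_add, hasseDeriv_zero',
          hasseDeriv_one', derivative_add, derivative_X, derivative_C, add_zero, one_mul]
        rw [ih (k + 1), ih k, Finset.powersetCard_succ_insert ha, Finset.sum_union, Finset.sum_image,
          Finset.mul_sum]
        · congr 1
          · refine Finset.sum_congr rfl fun S hS => ?_
            have hSU : S ⊆ U := (Finset.mem_powersetCard.mp hS).1
            have haS : a ∉ S := fun h => ha (hSU h)
            rw [Finset.insert_sdiff_of_notMem _ haS,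
              Finset.prod_insert (fun h => ha (Finset.sdiff_subset h))]
          · refine Finset.sum_congr rfl fun S _ => ?_
            rw [Finset.insert_sdiff_insert, Finset.sdiff_insert_of_notMem ha]
        · -- `insert a` is injective on subsets of `U` (`a ∉ U`)
          intro S hS T hT hST
          have hSU : S ⊆ U := (Finset.mem_powersetCard.mp (Finset.mem_coe.mp hS)).1
          have hTU : T ⊆ U := (Finset.mem_powersetCard.mp (Finset.mem_coe.mp hT)).1
          rw [← Finset.erase_insert (fun h => ha (hSU h)), hST,
            Finset.erase_insert (fun h => ha (hTU h))]
        · -- the two pieces are disjoint: `a ∉ S` on the left, `a ∈ S` on the right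
          rw [Finset.disjoint_left]
          intro S hS hS'
          have hSU : S ⊆ U := (Finset.mem_powersetCard.mp hS).1
          obtain ⟨T, -, rfl⟩ := Finset.mem_image.mp hS'
          exact ha (hSU (Finset.mem_insert_self a T))
      · rintro ⟨i, j⟩ hij hne
        have hsum : i + j = k := Finset.HasAntidiagonal.mem_antidiagonal.mp hij
        have hi : i ≠ 0 := by
          rintro rfl
          apply hne
          rw [zero_add] at hsum
          rw [hsum]
        simp only [Function.Embedding.coe_prodMap, Function.Embedding.coeFn_mk, Prod.map_apply,
          Function.Embedding.refl_apply, Nat.succ_eq_add_one]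
        rw [map_add, hasseDeriv_X _ (by omega), hasseDeriv_C _ _ (by omega), add_zero, zero_mul]

/-- **KP Theorem B (⇐), the determinantal identity** (proof of Thm. B: «if `T_{α,β}` is a special
Toeplitz matrix, then for any hyperbolic `p(z) = (z+λ₁)⋯(z+λ_d)` we have
`p + Σ_k a_k s^k p^{(k)} = det(zI + D + sT_{α,β})` where `a_i = t_{α,β}(i)/i!` and `D = diag(λ)`»),
stated with Hasse derivatives `p^{(k)}/k!` over any commutative ring:
`det(zI + D + sT_{α,β}) = Σ_{k=0}^{d} t_{α,β}(k) s^k · (p^{(k)}/k!)`.  (Principal-minor expansion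
`det(M + diag) = Σ_S ∏_{i∉S} diag_i · det M_S`, tree `Literature.Analysis.Matrix.det_add_diagonal_eq_sum_minors`,
and `p^{(k)}/k! = Σ_{|S|=k} ∏_{i∉S}(z + λ_i)`.) [cite: KurdykaPaunescu2017, Thm. B (proof, «if» direction)] -/
theorem det_pencil_specialToeplitz {R : Type*} [CommRing R] {d : ℕ} (μ : Fin d → R) (α β s : R) :
    ((X : R[X]) • 1 + (Matrix.diagonal μ).map C + C s • (specialToeplitz α β).map C).det =
      ∑ k ∈ Finset.range (d + 1), C (toeplitzDet α β k * s ^ k) *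
        hasseDeriv k (∏ i, (X + C (μ i))) := by
  have hdiag : (X : R[X]) • (1 : Matrix (Fin d) (Fin d) R[X]) + (Matrix.diagonal μ).map C =
      Matrix.diagonal fun i => X + C (μ i) := by
    rw [Matrix.diagonal_map (map_zero C), Matrix.smul_one_eq_diagonal, Matrix.diagonal_add]
  rw [hdiag, add_comm, Literature.Analysis.Matrix.det_add_diagonal_eq_sum_minors]
  -- each principal minor of `C s • T.map C` on `S` is `(C s)^{|S|} · C (t(|S|))`
  have hminor : ∀ S : Finset (Fin d),
      ((C s • (specialToeplitz α β : Matrix (Fin d) (Fin d) R).map C).submatrix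
          ((↑) : S → Fin d) ((↑) : S → Fin d) : Matrix S S R[X]).det =
        C (toeplitzDet α β S.card * s ^ S.card) := by
    intro S
    have hsub : ((C s • (specialToeplitz α β : Matrix (Fin d) (Fin d) R).map C).submatrix
        ((↑) : S → Fin d) ((↑) : S → Fin d)) = C s • (specialToeplitz (C α) (C β) : Matrix S S R[X]) := by
      ext i j
      simp only [Matrix.submatrix_apply, Matrix.smul_apply, Matrix.map_apply, specialToeplitz_apply,
        smul_eq_mul]
      by_cases h : i = j
      · subst h; simp
      · have h' : (i : Fin d) ≠ j := fun e => h (Subtype.ext e)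
        simp [h, h']
    rw [hsub, det_smul, det_specialToeplitz_card, Fintype.card_coe, ← map_toeplitzDet C, map_mul,
      map_pow, mul_comm]
  simp_rw [hminor]
  -- group the subsets by cardinality
  rw [← Finset.powerset_univ, Finset.powerset_card_disjiUnion, Finset.sum_disjiUnion,
    Finset.card_univ, Fintype.card_fin]
  refine Finset.sum_congr rfl fun k _ => ?_
  rw [hasseDeriv_prod_X_add_C μ Finset.univ k, Finset.mul_sum]
  refine Finset.sum_congr rfl fun S hS => ?_
  rw [(Finset.mem_powersetCard.mp hS).2, mul_comm, Finset.compl_eq_univ_sdiff]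

/-- The sequence `a_i = t_{α,β}(i)/i!` of Theorem B. [cite: KurdykaPaunescu2017, Thm. B (eq. (1.4))] -/
def toeplitzSeq (α β : ℝ) : ℕ → ℝ := fun k => toeplitzDet α β k / (Nat.factorial k : ℝ)

/-- Over `ℝ`: `Σ_{k ≤ d} t(k) s^k p^{(k)}/k! = p_a(z,s)` for `a = (t(k)/k!)_k` and `deg p ≤ d`
(`p^{(k)} = k! · (p^{(k)}/k!)`). [cite: KurdykaPaunescu2017, Thm. B (proof)] -/
theorem kpPencil_toeplitzSeq (α β : ℝ) (d : ℕ) (p : ℝ[X]) (s : ℝ) :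
    kpPencil (toeplitzSeq α β) d p s =
      ∑ k ∈ Finset.range (d + 1), C (toeplitzDet α β k * s ^ k) * hasseDeriv k p := by
  rw [kpPencil_def, Finset.range_eq_Ico, Finset.sum_eq_sum_Ico_succ_bot (Nat.succ_pos d),
    hasseDeriv_zero', toeplitzDet_zero, pow_zero, one_mul, map_one, one_mul]
  congr 1
  rw [show Finset.Ico 1 (d + 1) = Finset.Icc 1 d from rfl]
  refine Finset.sum_congr rfl fun k _ => ?_
  have hk : (derivative^[k] p) = (Nat.factorial k : ℝ[X]) * hasseDeriv k p := by
    rw [← factorial_smul_hasseDeriv, LinearMap.smul_apply, nsmul_eq_mul]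
  rw [hk, toeplitzSeq, ← mul_assoc, ← map_natCast C, ← map_mul]
  congr 2
  have : (Nat.factorial k : ℝ) ≠ 0 := by positivity
  field_simp

/-- **KP Theorem B (⇐): universal determinantal representation.** For every `α, β ∈ ℝ` the sequence
`a_i = t_{α,β}(i)/i!` admits the universal determinantal representation
`p_a(z,s) = det(zI + D + sT_{α,β})` (`p = ∏(z + λ_i)`, `D = diag(λ)`).
[cite: KurdykaPaunescu2017, Thm. B («if» direction) with Def. 1.3] -/
theorem hasUniversalDetRep_toeplitzSeq (α β : ℝ) (d : ℕ) : HasUniversalDetRep d (toeplitzSeq α β) :=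
  ⟨specialToeplitz α β, specialToeplitz_isSymm α β, fun μ s => by
    rw [kpPencil_toeplitzSeq, det_pencil_specialToeplitz]⟩

/-- Iterated derivatives commute with constant factors. [folklore] -/
private theorem iterate_derivative_C_mul' {R : Type*} [CommRing R] (c : R) (p : R[X]) (k : ℕ) :
    derivative^[k] (C c * p) = C c * derivative^[k] p := by
  induction k with
  | zero => rfl
  | succ k ih => rw [Function.iterate_succ_apply', ih, derivative_C_mul, Function.iterate_succ_apply']

/-- `kpPencil` is linear in `p`: scaling `p` by a constant scales the pencil.
[cite: KurdykaPaunescu2017, Def. 1.2] -/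
theorem kpPencil_C_mul {R : Type*} [CommRing R] (a : ℕ → R) (d : ℕ) (c : R) (p : R[X]) (s : R) :
    kpPencil a d (C c * p) s = C c * kpPencil a d p s := by
  rw [kpPencil_def, kpPencil_def, mul_add, Finset.mul_sum]
  congr 1
  refine Finset.sum_congr rfl fun k _ => ?_
  rw [iterate_derivative_C_mul']
  ring

/-- **KP Theorem B (⇐): `(t_{α,β}(i)/i!)_i` is a Nuij sequence** («so the sequence `a` is a Nuij
sequence with a universal determinantal representation»): `p_a(z,s) = c · det(zI + D + sT_{α,β})` for
hyperbolic `p = c∏(z + λ_i)`, and `det(zI + M)` is hyperbolic for real symmetric `M`.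
[cite: KurdykaPaunescu2017, Thm. B («if» direction)] -/
theorem isNuijSequence_toeplitzSeq (α β : ℝ) (d : ℕ) : IsNuijSequence d (toeplitzSeq α β) := by
  classical
  intro p hdeg hp s
  by_cases hp0 : p = 0
  · simp [hp0, kpPencil_def]
  -- `p = c · ∏_{i<d} (z + λ_i)` with `c` the leading coefficient and `−λ` an enumeration of the roots
  have hprod := hp.eq_prod_roots
  set l := p.roots.toList with hl
  have hlen : l.length = d := by
    rw [hl, Multiset.length_toList, ← hdeg]
    exact (hp.natDegree_eq_card_roots).symm
  subst hlen
  let μ : Fin l.length → ℝ := fun i => -l.get i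
  have hp' : p = C p.leadingCoeff * ∏ i, (X + C (μ i)) := by
    have h1 : ∏ i : Fin l.length, (X + C (μ i)) =
        (((univ : Finset (Fin l.length)).val.map l.get).map fun a => X - C a).prod := by
      rw [Multiset.map_map, ← Finset.prod_map_val]
      refine Finset.prod_congr rfl fun i _ => ?_
      simp [μ, sub_eq_add_neg]
    rw [h1, Fin.univ_val_map, List.ofFn_get, hl, Multiset.coe_toList]
    exact hprod
  rw [hp', kpPencil_C_mul, kpPencil_toeplitzSeq, ← det_pencil_specialToeplitz]
  refine (Splits.C _).mul ?_
  have hM : (X : ℝ[X]) • (1 : Matrix (Fin l.length) (Fin l.length) ℝ[X]) +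
      (Matrix.diagonal μ).map C + C s • (specialToeplitz α β).map C =
      (X : ℝ[X]) • 1 + (Matrix.diagonal μ + s • specialToeplitz α β).map C := by
    refine Matrix.ext fun i j => ?_
    by_cases h : i = j
    · subst h; simp [add_assoc]
    · simp [h]
  rw [hM]
  exact splits_det_X_add_of_isSymm ((Matrix.isSymm_diagonal μ).add
    ((specialToeplitz_isSymm α β).smul s))

end ThmB

/-! ## §2.1: composition (iteration) of Nuij sequences; Theorem A (⇒) -/

section Composition

variable {R : Type*} [CommRing R]

/-- The convention `a_0 = 1` of KP §2.1. [cite: KurdykaPaunescu2017, §2.1 (eq. (2.1))] -/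
def seqCoeff (a : ℕ → R) (i : ℕ) : R := if i = 0 then 1 else a i

/-- `a_0 = 1`. [cite: KurdykaPaunescu2017, §2.1 (convention before eq. (2.1))] -/
@[simp] theorem seqCoeff_zero (a : ℕ → R) : seqCoeff a 0 = 1 := rfl

/-- `a_i` for `i ≥ 1` is the given sequence. [cite: KurdykaPaunescu2017, §2.1 (convention before eq. (2.1))] -/
theorem seqCoeff_of_ne_zero (a : ℕ → R) {i : ℕ} (hi : i ≠ 0) : seqCoeff a i = a i := if_neg hi

/-- **KP §2.1, eq. (2.1): composition of sequences** `b ∘ a = c`, `c_k = Σ_{i=0}^{k} a_i b_{k−i}`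
(`a_0 = b_0 = 1`). [cite: KurdykaPaunescu2017, §2.1 (eq. (2.1))] -/
def kpComp (a b : ℕ → R) : ℕ → R :=
  fun k => ∑ ij ∈ Finset.HasAntidiagonal.antidiagonal k, seqCoeff a ij.1 * seqCoeff b ij.2

/-- `c_0 = 1`, so the convention `c_0 = 1` is automatic. [cite: KurdykaPaunescu2017, §2.1 (eq. (2.1))] -/
theorem seqCoeff_kpComp (a b : ℕ → R) (k : ℕ) : seqCoeff (kpComp a b) k = kpComp a b k := by
  by_cases hk : k = 0
  · subst hk; simp [kpComp]
  · exact seqCoeff_of_ne_zero _ hk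

/-- The symbol `Σ_{k ≤ d} a_k s^k T^k ∈ R[T]` of the operator `p ↦ p_a(z,s)` (`T ↦ d/dz`).
[cite: KurdykaPaunescu2017, Def. 1.2 and §2.1] -/
def seqPoly (a : ℕ → R) (d : ℕ) (s : R) : R[X] :=
  ∑ k ∈ Finset.range (d + 1), C (seqCoeff a k * s ^ k) * X ^ k

/-- Coefficients of the operator symbol: `a_i s^i` for `i ≤ d`, `0` beyond.
[cite: KurdykaPaunescu2017, Def. 1.2 and §2.1] -/
theorem coeff_seqPoly (a : ℕ → R) (d : ℕ) (s : R) (i : ℕ) :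
    (seqPoly a d s).coeff i = if i ≤ d then seqCoeff a i * s ^ i else 0 := by
  rw [seqPoly, finsetSum_coeff]
  simp_rw [coeff_C_mul_X_pow]
  rw [Finset.sum_ite_eq (Finset.range (d + 1)) i]
  simp only [Finset.mem_range, Nat.lt_succ_iff]

/-- The operator symbol has degree `≤ d` in `T`. [cite: KurdykaPaunescu2017, Def. 1.2 and §2.1] -/
theorem natDegree_seqPoly_le (a : ℕ → R) (d : ℕ) (s : R) : (seqPoly a d s).natDegree ≤ d := by
  refine Polynomial.natDegree_sum_le_of_forall_le _ _ fun k hk => ?_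
  exact (natDegree_C_mul_X_pow_le _ _).trans (Nat.lt_succ_iff.mp (Finset.mem_range.mp hk))

/-- The differential operator `Q(D)`: `(aeval D Q) p = Σ_i Q_i · p^{(i)}` (any `n > deg Q`). [folklore] -/
private theorem aeval_derivative_apply (Q p : R[X]) {n : ℕ} (hn : Q.natDegree < n) :
    (aeval (Polynomial.derivative : R[X] →ₗ[R] R[X]) Q : Module.End R R[X]) p =
      ∑ i ∈ Finset.range n, C (Q.coeff i) * derivative^[i] p := by
  rw [aeval_eq_sum_range' hn, LinearMap.sum_apply]
  refine Finset.sum_congr rfl fun i _ => ?_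
  rw [LinearMap.smul_apply, Module.End.pow_apply, smul_eq_C_mul]

/-- `p_a(z,s) = A(D) p` with `A = seqPoly a d s`. [cite: KurdykaPaunescu2017, Def. 1.2 and §2.1] -/
theorem kpPencil_eq_aeval (a : ℕ → R) (d : ℕ) (p : R[X]) (s : R) :
    kpPencil a d p s =
      (aeval (Polynomial.derivative : R[X] →ₗ[R] R[X]) (seqPoly a d s) : Module.End R R[X]) p := by
  rw [aeval_derivative_apply _ _ (Nat.lt_succ_of_le (natDegree_seqPoly_le a d s)), kpPencil_def,
    Finset.range_eq_Ico, Finset.sum_eq_sum_Ico_succ_bot (Nat.succ_pos d)]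
  congr 1
  · rw [coeff_seqPoly, if_pos (Nat.zero_le d), seqCoeff_zero, pow_zero, mul_one, map_one, one_mul,
      Function.iterate_zero, id_eq]
  · refine Finset.sum_congr rfl fun k hk => ?_
    rw [Finset.mem_Ico] at hk
    rw [coeff_seqPoly, if_pos (by omega), seqCoeff_of_ne_zero _ (by omega)]

/-- **KP §2.1: `(p_a)_b = p_c` with `c = b ∘ a`** for `deg p ≤ d` (the orders `> d` of `D` kill `p`).
[cite: KurdykaPaunescu2017, §2.1 (eq. (2.1))] -/
theorem kpPencil_kpPencil (a b : ℕ → R) (d : ℕ) (p : R[X]) (hp : p.natDegree ≤ d) (s : R) :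
    kpPencil b d (kpPencil a d p s) s = kpPencil (kpComp a b) d p s := by
  rw [kpPencil_eq_aeval, kpPencil_eq_aeval, kpPencil_eq_aeval, ← Module.End.mul_apply, ← map_mul]
  have hdeg : (seqPoly b d s * seqPoly a d s).natDegree < d + 1 + d + 1 := by
    refine Nat.lt_of_le_of_lt (natDegree_mul_le) ?_
    have := natDegree_seqPoly_le a d s
    have := natDegree_seqPoly_le b d s
    omega
  rw [aeval_derivative_apply _ _ hdeg,
    aeval_derivative_apply _ _ (Nat.lt_succ_of_le (natDegree_seqPoly_le _ d s)),
    show d + 1 + d + 1 = (d + 1) + (d + 1) by ring, Finset.range_add, Finset.sum_union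
      (Finset.disjoint_range_addLeftEmbedding _ _), Finset.sum_map]
  -- the orders `> d` vanish on `p`
  have hzero : ∑ x ∈ Finset.range (d + 1),
      C ((seqPoly b d s * seqPoly a d s).coeff (addLeftEmbedding (d + 1) x)) *
        derivative^[addLeftEmbedding (d + 1) x] p = 0 :=
    Finset.sum_eq_zero fun i _ => by
      rw [addLeftEmbedding_apply, iterate_derivative_eq_zero (by omega), mul_zero]
  rw [hzero, add_zero]
  refine Finset.sum_congr rfl fun i hi => ?_
  have hid : i ≤ d := Nat.lt_succ_iff.mp (Finset.mem_range.mp hi)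
  congr 2
  rw [coeff_seqPoly, if_pos hid, seqCoeff_kpComp, kpComp, coeff_mul, Finset.sum_mul]
  conv_lhs => rw [← Finset.Nat.sum_antidiagonal_swap]
  refine Finset.sum_congr rfl fun x hx => ?_
  have hx' : x.1 + x.2 = i := Finset.HasAntidiagonal.mem_antidiagonal.mp hx
  rw [Prod.fst_swap, Prod.snd_swap, coeff_seqPoly, coeff_seqPoly, if_pos (by omega), if_pos (by omega),
    ← hx', pow_add]
  ring

/-- `p_a(z,s)` has the same degree as `p` (the derivatives have smaller degree).
[cite: KurdykaPaunescu2017, §3 («each coefficient `a_i(s)` is of degree at most `i`»; degree in `z`)] -/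
theorem natDegree_kpPencil (a : ℕ → R) (d : ℕ) (p : R[X]) (s : R) :
    (kpPencil a d p s).natDegree = p.natDegree := by
  rw [kpPencil_def]
  by_cases hp : p.natDegree = 0
  · have hzero : ∑ k ∈ Finset.Icc 1 d, C (a k * s ^ k) * derivative^[k] p = 0 := by
      refine Finset.sum_eq_zero fun k hk => ?_
      rw [Finset.mem_Icc] at hk
      rw [iterate_derivative_eq_zero (by omega), mul_zero]
    rw [hzero, add_zero]
  · apply natDegree_add_eq_left_of_natDegree_lt
    have hle : (∑ k ∈ Finset.Icc 1 d, C (a k * s ^ k) * derivative^[k] p).natDegree ≤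
        p.natDegree - 1 := by
      refine Polynomial.natDegree_sum_le_of_forall_le _ _ fun k hk => ?_
      rw [Finset.mem_Icc] at hk
      refine (natDegree_C_mul_le _ _).trans ((natDegree_iterate_derivative p k).trans ?_)
      omega
    omega

/-- A degree-`0` convention: every sequence is a Nuij sequence for `d = 0` (the pencil is `p`).
[cite: KurdykaPaunescu2017, Def. 1.2] -/
theorem isNuijSequence_zero (a : ℕ → ℝ) : IsNuijSequence 0 a := by
  intro p _ hp s
  rw [kpPencil_def, Finset.Icc_eq_empty (by omega), Finset.sum_empty, add_zero]
  exact hp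

/-- **KP §2.1: Nuij sequences are closed under composition** (`(p_a)_b = p_{b∘a}` and `p_a` is
hyperbolic of degree `d` whenever `p` is). [cite: KurdykaPaunescu2017, §2.1] -/
theorem IsNuijSequence.comp {d : ℕ} {a b : ℕ → ℝ} (ha : IsNuijSequence d a) (hb : IsNuijSequence d b) :
    IsNuijSequence d (kpComp a b) := by
  intro p hdeg hp s
  rw [← kpPencil_kpPencil a b d p hdeg.le s]
  exact hb _ (by rw [natDegree_kpPencil, hdeg]) (ha p hdeg hp s) s

/-- The sequences `(x, 0, …, 0)` of KP (2.2). [cite: KurdykaPaunescu2017, §2.1 (eq. (2.2))] -/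
def singleSeq (x : ℝ) : ℕ → ℝ := fun k => if k = 1 then x else 0

/-- `nuijSeq = singleSeq 1`. [cite: KurdykaPaunescu2017, §1 and §2.1 (eq. (2.2))] -/
theorem nuijSeq_eq_singleSeq : nuijSeq = singleSeq 1 := rfl

/-- For `a = (x,0,…,0)` and `d ≥ 1` the pencil is `p + x s p'`. [cite: KurdykaPaunescu2017, §2.1 (eq. (2.2))] -/
theorem kpPencil_singleSeq (x : ℝ) (d : ℕ) (hd : 1 ≤ d) (p : ℝ[X]) (s : ℝ) :
    kpPencil (singleSeq x) d p s = p + C (x * s) * derivative p := by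
  rw [kpPencil_def, Finset.sum_eq_single_of_mem 1 (Finset.mem_Icc.mpr ⟨le_rfl, hd⟩)]
  · simp [singleSeq]
  · intro k hk hk1
    simp [singleSeq, hk1]

/-- **`(x, 0, …, 0)` is a Nuij sequence** (Nuij's theorem with `xs` in place of `s`).
[cite: KurdykaPaunescu2017, §2.1 (eq. (2.2)) with Thm. 1.1] -/
theorem isNuijSequence_singleSeq (x : ℝ) (d : ℕ) : IsNuijSequence d (singleSeq x) := by
  rcases Nat.eq_zero_or_pos d with hd | hd
  · subst hd; exact isNuijSequence_zero _
  · intro p _ hp s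
    rw [kpPencil_singleSeq x d hd]
    exact nuij_theorem hp (x * s)

/-- Elementary symmetric functions of a multiset: `e_{k+1}(x ∷ X) = e_{k+1}(X) + x·e_k(X)`. [folklore] -/
private theorem esymm_cons_succ (x : ℝ) (X : Multiset ℝ) (k : ℕ) :
    (x ::ₘ X).esymm (k + 1) = X.esymm (k + 1) + x * X.esymm k := by
  rw [Multiset.esymm, Multiset.powersetCard_cons, Multiset.map_add, Multiset.sum_add, Multiset.map_map,
    Multiset.esymm, Multiset.esymm, ← Multiset.sum_map_mul_left]
  congr 2
  refine Multiset.map_congr rfl fun t _ => ?_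
  simp

/-- Composing with `(x,0,…,0)` is the Viète step `c_k = e_k(X) + x e_{k−1}(X) = e_k(x ∷ X)`
(KP (2.3)). [cite: KurdykaPaunescu2017, §2.1 (eq. (2.1)–(2.3))] -/
theorem kpComp_esymm_singleSeq (X : Multiset ℝ) (x : ℝ) :
    kpComp (fun k => X.esymm k) (singleSeq x) = fun k => (x ::ₘ X).esymm k := by
  funext k
  have hX : ∀ j, seqCoeff (fun k => X.esymm k) j = X.esymm j := by
    intro j
    by_cases hj : j = 0
    · subst hj; rw [seqCoeff_zero, Multiset.esymm, Multiset.powersetCard_zero_left]; simp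
    · exact seqCoeff_of_ne_zero _ hj
  cases k with
  | zero =>
    rw [kpComp, Finset.Nat.antidiagonal_zero, Finset.sum_singleton, Multiset.esymm,
      Multiset.powersetCard_zero_left]
    simp
  | succ k =>
    rw [esymm_cons_succ, kpComp, Finset.Nat.antidiagonal_succ', Finset.sum_cons, Finset.sum_map,
      Finset.sum_eq_single_of_mem (k, 0) (Finset.HasAntidiagonal.mem_antidiagonal.mpr (add_zero k))]
    · simp only [Function.Embedding.coe_prodMap, Function.Embedding.coeFn_mk, Prod.map_apply,
        Function.Embedding.refl_apply, Nat.succ_eq_add_one, hX, seqCoeff_zero, mul_one]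
      rw [seqCoeff_of_ne_zero _ (by omega)]
      simp [singleSeq, mul_comm]
    · rintro ⟨i, j⟩ hij hne
      have hsum : i + j = k := Finset.HasAntidiagonal.mem_antidiagonal.mp hij
      have hj : j ≠ 0 := by
        rintro rfl
        apply hne
        rw [add_zero] at hsum
        rw [hsum]
      simp only [Function.Embedding.coe_prodMap, Function.Embedding.coeFn_mk, Prod.map_apply,
        Function.Embedding.refl_apply, Nat.succ_eq_add_one]
      rw [seqCoeff_of_ne_zero (singleSeq x) (by omega)]
      simp [singleSeq, hj]

/-- **KP §2.1, eq. (2.3) / Cor. 2.4 (`𝓗_1^d ⊂ 𝓝_d`): Viète sequences are Nuij sequences.** For every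
finite multiset `X` of reals, `(e_1(X), e_2(X), …)` — the iteration of the Nuij sequences `(x,0,…,0)`,
`x ∈ X` — is a Nuij sequence (for every `d`). [cite: KurdykaPaunescu2017, §2.1 (eq. (2.3)) and Cor. 2.4 (first inclusion)] -/
theorem isNuijSequence_esymm (X : Multiset ℝ) (d : ℕ) : IsNuijSequence d fun k => X.esymm k := by
  induction X using Multiset.induction with
  | empty =>
    intro p _ hp s
    have h0 : kpPencil (fun k => (0 : Multiset ℝ).esymm k) d p s = p := by
      rw [kpPencil_def, Finset.sum_eq_zero, add_zero]
      intro k hk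
      rw [Finset.mem_Icc] at hk
      obtain ⟨k', rfl⟩ := Nat.exists_eq_succ_of_ne_zero (by omega : k ≠ 0)
      rw [Multiset.esymm, Multiset.powersetCard_zero_right, Multiset.map_zero, Multiset.sum_zero,
        zero_mul, map_zero, zero_mul]
    rw [h0]; exact hp
  | cons x X ih =>
    rw [← kpComp_esymm_singleSeq]
    exact ih.comp (isNuijSequence_singleSeq x d)

/-- The test polynomial `q_a(z) = z^d + Σ_k a_k (z^d)^{(k)}` of Theorem A (`= p_a(z,1)` for `p = z^d`).
[cite: KurdykaPaunescu2017, Thm. A (eq. (1.2))] -/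
def qPoly (a : ℕ → ℝ) (d : ℕ) : ℝ[X] := kpPencil a d (X ^ d) 1

/-- **KP Theorem A, «only if» (the trivial direction):** if `a` is a Nuij sequence then
`q_a = p_a(z,1)` for the hyperbolic `p = z^d` is hyperbolic.  (The converse is Borcea–Brändén and is
not typed.) [cite: KurdykaPaunescu2017, Thm. A] -/
theorem IsNuijSequence.splits_qPoly {d : ℕ} {a : ℕ → ℝ} (ha : IsNuijSequence d a) : (qPoly a d).Splits :=
  ha (X ^ d) (natDegree_X_pow d) (by simp) 1

end Composition

/-! ## Example 2.5: `d = 2` -/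

section Example25

/-- A monic real quadratic with a non-negative discriminant is hyperbolic. [folklore] -/
private theorem splits_quadratic_of_discrim_nonneg (b c : ℝ) (h : 0 ≤ b ^ 2 - 4 * c) :
    (X ^ 2 + C b * X + C c : ℝ[X]).Splits := by
  set δ := Real.sqrt (b ^ 2 - 4 * c) with hδ
  have hδ2 : δ * δ = b ^ 2 - 4 * c := Real.mul_self_sqrt h
  set r₁ := (-b + δ) / 2 with hr₁
  set r₂ := (-b - δ) / 2 with hr₂
  have hb : (C b : ℝ[X]) = -(C r₁ + C r₂) := by
    rw [← map_add, ← map_neg]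
    congr 1
    rw [hr₁, hr₂]; ring
  have hc : (C c : ℝ[X]) = C r₁ * C r₂ := by
    rw [← map_mul]
    congr 1
    rw [hr₁, hr₂]; nlinarith [hδ2]
  have hfac : (X ^ 2 + C b * X + C c : ℝ[X]) = (X - C r₁) * (X - C r₂) := by
    rw [hb, hc]; ring
  rw [hfac]
  exact (Splits.X_sub_C _).mul (Splits.X_sub_C _)

/-- A hyperbolic monic real quadratic has a non-negative discriminant (`b² − 4c = (b + 2u)²` at a
root `u`). [folklore] -/
private theorem discrim_nonneg_of_splits_quadratic (b c : ℝ)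
    (h : (X ^ 2 + C b * X + C c : ℝ[X]).Splits) : 0 ≤ b ^ 2 - 4 * c := by
  classical
  set q : ℝ[X] := X ^ 2 + C b * X + C c with hq
  have hdeg : q.natDegree = 2 := by rw [hq]; compute_degree!
  have hcard : q.roots.card = 2 := by rw [← hdeg]; exact (h.natDegree_eq_card_roots).symm
  obtain ⟨u, hu⟩ : ∃ u, u ∈ q.roots :=
    Multiset.card_pos_iff_exists_mem.mp (by rw [hcard]; norm_num)
  have hq0 : q ≠ 0 := fun h0 => by rw [h0, natDegree_zero] at hdeg; exact absurd hdeg (by norm_num)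
  have hroot : q.eval u = 0 := (mem_roots hq0).mp hu
  have heval : q.eval u = u ^ 2 + b * u + c := by rw [hq]; simp
  rw [heval] at hroot
  nlinarith [sq_nonneg (b + 2 * u)]

/-- **KP Example 2.5 (`d = 2`), the set `𝓝_2`, proved directly:**
`𝓝_2 = {a_1² − 2a_2 ≥ 0}` («`⊂ 𝓝_2 = {a_1² − 2a_2 ≥ 0}`»).  The source derives this from Thm. A
(Borcea–Brändén); here: for `p = c(z−u)(z−v)` the discriminant of `p + a_1 s p' + a_2 s² p''` is
`c²((u−v)² + 4s²(a_1² − 2a_2))`, and `p = z²`, `s = 1` gives the converse. [cite: KurdykaPaunescu2017, Example 2.5] -/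
theorem isNuijSequence_two_iff (a : ℕ → ℝ) : IsNuijSequence 2 a ↔ 0 ≤ a 1 ^ 2 - 2 * a 2 := by
  have hpencil : ∀ (p : ℝ[X]) (s : ℝ), kpPencil a 2 p s =
      p + C (a 1 * s) * derivative p + C (a 2 * s ^ 2) * derivative (derivative p) := by
    intro p s
    rw [kpPencil_def, show Finset.Icc 1 2 = {1, 2} from rfl, Finset.sum_insert (by simp),
      Finset.sum_singleton, pow_one, Function.iterate_one, Function.iterate_succ_apply',
      Function.iterate_one, add_assoc]
  constructor
  · intro ha
    have h := ha (X ^ 2) (natDegree_X_pow 2) (by simp) 1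
    rw [hpencil] at h
    have hX : (X ^ 2 : ℝ[X]) + C (a 1 * 1) * derivative (X ^ 2) +
        C (a 2 * 1 ^ 2) * derivative (derivative (X ^ 2)) =
        X ^ 2 + C (2 * a 1) * X + C (2 * a 2) := by
      rw [mul_one, one_pow, mul_one, derivative_X_sq, derivative_C_mul, derivative_X, mul_one, map_mul,
        map_mul]
      ring
    rw [hX] at h
    have := discrim_nonneg_of_splits_quadratic _ _ h
    nlinarith [this]
  · intro ha p hdeg hp s
    rw [hpencil]
    -- `p = c (z − u)(z − v)`, `c ≠ 0`
    classical
    have hp0 : p ≠ 0 := fun h0 => by rw [h0, natDegree_zero] at hdeg; exact absurd hdeg (by norm_num)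
    have hcard : p.roots.card = 2 := by rw [← hdeg]; exact (hp.natDegree_eq_card_roots).symm
    obtain ⟨u, v, huv⟩ := Multiset.card_eq_two.mp hcard
    have hprod := hp.eq_prod_roots
    rw [huv] at hprod
    simp only [Multiset.insert_eq_cons, Multiset.map_cons, Multiset.map_singleton,
      Multiset.prod_cons, Multiset.prod_singleton] at hprod
    set c := p.leadingCoeff with hc
    -- the perturbed quadratic, written as `c · (z² + B z + C₀)`
    set B := 2 * a 1 * s - (u + v) with hB
    set C₀ := u * v - a 1 * s * (u + v) + 2 * a 2 * s ^ 2 with hC₀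
    have hp' : p = C c * (X ^ 2 - C (u + v) * X + C (u * v)) := by
      rw [hprod, map_add, map_mul]; ring
    have hd1 : derivative p = C c * (C 2 * X - C (u + v)) := by
      rw [hp', derivative_C_mul, derivative_add, derivative_sub, derivative_X_sq, derivative_C_mul,
        derivative_X, derivative_C, mul_one, add_zero]
    have hd2 : derivative (derivative p) = C c * C 2 := by
      rw [hd1, derivative_C_mul, derivative_sub, derivative_C_mul, derivative_X, derivative_C, mul_one,
        sub_zero]
    have hq : p + C (a 1 * s) * derivative p + C (a 2 * s ^ 2) * derivative (derivative p) =
        C c * (X ^ 2 + C B * X + C C₀) := by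
      rw [hd2, hd1, hp', hB, hC₀]
      simp only [map_mul, map_sub, map_add, map_pow]
      ring
    rw [hq]
    refine (Splits.C c).mul (splits_quadratic_of_discrim_nonneg B C₀ ?_)
    have hdisc : B ^ 2 - 4 * C₀ = (u - v) ^ 2 + 4 * s ^ 2 * (a 1 ^ 2 - 2 * a 2) := by
      rw [hB, hC₀]; ring
    rw [hdisc]
    positivity

/-- **KP Example 2.5, the set `𝓗_1^2`:** the Viète image `{(x+y, xy)}` is `{a_1² − 4a_2 ≥ 0}`.
[cite: KurdykaPaunescu2017, Example 2.5] -/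
theorem viete_two_iff (a₁ a₂ : ℝ) : (∃ x y : ℝ, a₁ = x + y ∧ a₂ = x * y) ↔ 0 ≤ a₁ ^ 2 - 4 * a₂ := by
  constructor
  · rintro ⟨x, y, rfl, rfl⟩
    nlinarith [sq_nonneg (x - y)]
  · intro h
    refine ⟨(a₁ + Real.sqrt (a₁ ^ 2 - 4 * a₂)) / 2, (a₁ - Real.sqrt (a₁ ^ 2 - 4 * a₂)) / 2, by ring, ?_⟩
    nlinarith [Real.mul_self_sqrt h]

/-- **KP Example 2.5, the inclusion `𝓗_1^2 ⊂ 𝓝_2` numerically:** `a_1² − 4a_2 ≥ 0 ⇒ a_1² − 2a_2 ≥ 0`.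
[cite: KurdykaPaunescu2017, Example 2.5] -/
theorem example_2_5_inclusion (a₁ a₂ : ℝ) (h : 0 ≤ a₁ ^ 2 - 4 * a₂) : 0 ≤ a₁ ^ 2 - 2 * a₂ := by
  nlinarith [sq_nonneg a₁]

end Example25

end Literature.AlgebraicGeometry.DeterminantalHypersurfaces.KurdykaPaunescu2017
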